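import Literature.AlgebraicGeometry.HodgeTheory.FermatJuxtapositionGysin
import Literature.AlgebraicGeometry.HodgeTheory.ComplexGysinRational
import Literature.AlgebraicGeometry.Motives.ComplexPointsOrientation
import Literature.AlgebraicGeometry.HodgeTheory.ShiodaClaimPairedProofs
import HarnessLib

/-!
# Push-forward transfer of algebraic classes along a morphism of non-zero degree, and `stub_claimLevelPush` from the level map — line `cancel-by-any-claim-lattice`, crux `HodgeFermatVarieties` (stmt-HodgeConjecture-1334)

Helper file (`--supports stmt-HodgeConjecture-1334`) for the stub `stub_claimLevelPush` (S2↓) of the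
skeleton of line `cancel-by-any-claim-lattice`: claim_{km}(k • α') ⟹ claim_m(α') for the level map
`π : X²ʳ_{km} → X²ʳₘ`, `[xᵢ] ↦ [xᵢᵏ]` (Shioda–Katsura, Tôhoku Math. J. 31 (1979) §1; Aoki, J. Math.
Soc. Japan 39 (1987) p. 387 and Cor. 2-3; da Silva, arXiv:2101.04739 Thm. 2.8). On paper:
`V_m(α') = (deg π)⁻¹ π_* π^* V_m(α') ⊆ (deg π)⁻¹ π_* V_{km}(k•α') ⊆ π_*(Alg) ⊆ Alg` (projection
formula `π_* π^* = deg π · id`, Fulton, *Young Tableaux* App. B (6)–(7); proper push-forward of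
supported classes stays supported with the codimension preserved, `dim X_{km} = dim X_m`, App. B
§B.2 Ex. 5 / Voisin II Prop. 9.21 (ii)).

PROVED here, UNCONDITIONALLY, on the tree's real carriers (`complexBetti = H*(–(ℂ); ℂ)`,
`algebraicClasses X p = Nᵖ H²ᵖ`, the Gysin morphisms `complexGysin μ` of `HodgeTheory/ComplexGysin`
for an arbitrary orientation family `μ`; Poincaré duality is the tree's theorem
`OrientationFamily.hasPoincareDuality`, the support form of App. B §B.2 Ex. 5 the tree's theorem
`gysinMap_restrictCompl_eq_zero_of_field ℂ`), for `f : Y ⟶ X` of smooth projective varieties of the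
SAME dimension `n`:

* `mem_algebraicClasses_of_pushPull` — **the transfer lemma**: if `f_* (f^* x) = c • x`, `c ≠ 0`, and
  `f^* x ∈ Nᵖ H²ᵖ(Y(ℂ))`, then `x ∈ Nᵖ H²ᵖ(X(ℂ))` (`f_*` preserves `Nᵖ H²ᵖ` in equal dimensions,
  `complexGysin_mem_supportedClasses`; `x = c⁻¹ f_* f^* x`); with `complexGysin_map_of_hasDegree`
  (`f_* f^* = d •` from `f(ℂ)_* [Y(ℂ)]_μ = d • [X(ℂ)]_μ`, the tree's `gysinMap_map_of_hasDegree`) the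
  `HasDegree` form `mem_algebraicClasses_of_map_mem_of_hasDegree`, the equivalence
  `map_mem_algebraicClasses_iff_of_hasDegree` for `f` flat, the submodule form `le_algebraicClasses_of_pushPull`;
* `exists_complexGysin_map_eq_smul` — the push-pull scalar `c` with `f_* f^* = c •` in every degree
  EXISTS unconditionally (`H₂ₙ(X(ℂ); ℂ) = ℂ · [X(ℂ)]`, Hatcher Thm. 3.26), `complexGysin_top_injective`
  — `f_*` is injective on `H²ⁿ` (`H₀` of the path-connected `Y(ℂ)` injects, Hatcher Prop. 2.7), hence
  `pushPull_scalar_ne_zero` — `c ≠ 0` as soon as `f^*` is non-zero on `H²ⁿ(X(ℂ); ℂ)`;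
* `stub_claimLevelPush_of_pushPull` / `_of_levelMap` / `_of_map_top_ne_zero` — **S2↓ from the level
  map**: GRANTED, for `m, k, r ≥ 1`, a morphism `π : fermatHypersurface (2r) (km) ⟶ fermatHypersurface (2r) m`
  with (M2) `π^* V_m(α') ⊆ V_{km}(k • α')` for zero-free `α'` and ONE of (M5) `π_* π^* = c •` on `H²ʳ`,
  `c ≠ 0` / `HasDegree (μ hX_{km}) (μ hX_m) π(ℂ) d`, `d ≠ 0` / (M5′) `π^* ≠ 0` on `H⁴ʳ(X²ʳₘ(ℂ); ℂ)`,
  the registered statement of `stub_claimLevelPush` follows (degenerate cases: `r = 0`, `N⁰ H⁰ = H⁰`,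
  `FermatCharacter.claim_zero`; `m = 0`, `V₊(Σ xᵢ⁰) = ∅`, `isEmpty_fermatHypersurface_zero_left`).
  REMAINING CONSTRUCTIONS (not in the tree, 2026-08-16): (M1) the morphism `π` (the graded
  endomorphism `xᵢ ↦ xᵢᵏ` of `ℂ[x₀, …, x_{2r+1}]` scales degrees by `k`, outside Mathlib's `Proj.map`),
  (M2) its intertwining `π ∘ g_a = g_{aᵏ} ∘ π` with the diagonal symmetries read on `fermatEigenspace`,
  (M5′) `π^* [pt] ≠ 0` (in print `π(ℂ)_* [X_{km}(ℂ)] = k^{2r+1} [X_m(ℂ)]`).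

## References

* [FultonYoungTableaux1997] W. Fulton, Young Tableaux, CUP 1997, App. B §B.1 (5)–(7), §B.2 Ex. 5.
* [VoisinHodgeII2003] C. Voisin, Hodge Theory and Complex Algebraic Geometry II, Prop. 9.21 (ii).
* [HatcherAT2002] A. Hatcher, Algebraic Topology, CUP 2002, Prop. 2.7, §3.3 Thm. 3.26 and 3.30.
* [ShiodaKatsura1979] T. Shioda, T. Katsura, On Fermat varieties, Tôhoku Math. J. 31 (1979), §1.
* [Aoki1987] N. Aoki, Some new algebraic cycles on Fermat varieties, J. Math. Soc. Japan 39 (1987), Cor. 2-3.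
* [daSilva2021HodgeFermat] G. da Silva Jr., arXiv:2101.04739, Thm. 2.8.
* [GrothendieckTopology1969] A. Grothendieck, Topology 8 (1969), §1.
-/

set_option linter.dupNamespace false

noncomputable section

open CategoryTheory AlgebraicGeometry Finset
open Literature.AlgebraicGeometry Literature.AlgebraicGeometry.Motives
open Literature.AlgebraicGeometry.HodgeTheory Literature.AlgebraicGeometry.HodgeTheory.FermatCharacter
open Literature.AlgebraicTopology.SingularHomology

namespace Summit.HodgeConjecture.HodgeConjecture.Theorems.CancelByAnyClaimLattice

/-! ### Push-pull along a morphism of non-zero degree (Fulton, App. B (6)–(7)) -/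

section Transfer

variable (μ : OrientationFamily) {n : ℕ} {Y X : Motives.SchemeOver ℂ}

/-- **`f_* (f^* x) = d • x` in every degree** for a morphism `f : Y ⟶ X` of smooth projective complex
varieties of the same dimension `n` whose map of complex points has degree `d` for the orientation
family `μ` (`f(ℂ)_* [Y(ℂ)]_μ = d • [X(ℂ)]_μ`): in degrees `a ≤ 2n` this is the tree's
`gysinMap_map_of_hasDegree` (projection formula with `f_* 1 = d • 1`), Poincaré duality for `X(ℂ)`
being `OrientationFamily.hasPoincareDuality`; above `2n` both sides vanish.
[cite: FultonYoungTableaux1997, Appendix B §B.1 (6) and (7)] -/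
theorem complexGysin_map_of_hasDegree (hY : IsSmoothProjective n Y) (hX : IsSmoothProjective n X)
    (f : Y ⟶ X) {d : ℤ} (hf : HasDegree (μ hY) (μ hX) (AlgPoints.mapContinuous (L := ℂ) f) d)
    {a : ℕ} (x : complexBetti X a) :
    complexGysin μ hY hX f rfl (complexBetti.map f a x) = d • x := by
  by_cases ha : a ≤ 2 * n
  · rw [complexGysin_eq_gysinMap hY hX f rfl (q := 2 * n - a) (by omega) (by omega)]
    exact gysinMap_map_of_hasDegree (OrientationFamily.hasPoincareDuality μ hX) hf _ x
  · haveI := subsingleton_complexBetti hX (not_le.1 ha)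
    exact Subsingleton.elim _ _

/-- **Transfer of algebraic classes (push-pull form).** For `f : Y ⟶ X` between smooth projective
varieties of the same dimension and a class `x ∈ H²ᵖ(X(ℂ); ℂ)` with `f_* (f^* x) = c • x`, `c ≠ 0`:
if `f^* x` is algebraic on `Y` then `x` is algebraic on `X` — `f_*` maps `Nᵖ H²ᵖ(Y(ℂ))` into
`Nᵖ H²ᵖ(X(ℂ))` (proper push-forward of supports, codimension preserved in equal dimensions:
`complexGysin_mem_supportedClasses` with the tree's theorems `gysinMap_restrictCompl_eq_zero_of_field ℂ`
and `OrientationFamily.hasPoincareDuality`), and `x = c⁻¹ • f_* f^* x`.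
[cite: FultonYoungTableaux1997, Appendix B §B.1 (6)–(7) and §B.2 Exercise 5] [cite: GrothendieckTopology1969, §1] -/
theorem mem_algebraicClasses_of_pushPull (hY : IsSmoothProjective n Y) (hX : IsSmoothProjective n X)
    (f : Y ⟶ X) {p : ℕ} {c : ℂ} (hc : c ≠ 0) {x : complexBetti X (2 * p)}
    (hpp : complexGysin μ hY hX f rfl (complexBetti.map f (2 * p) x) = c • x)
    (hx : complexBetti.map f (2 * p) x ∈ algebraicClasses Y p) : x ∈ algebraicClasses X p := by
  have h : complexGysin μ hY hX f rfl (complexBetti.map f (2 * p) x) ∈ algebraicClasses X p :=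
    complexGysin_mem_supportedClasses (gysinMap_restrictCompl_eq_zero_of_field ℂ) μ
      (OrientationFamily.hasPoincareDuality μ) hY hX f _ (le_of_eq (add_comm p n)) hx
  rw [hpp] at h
  exact (Submodule.smul_mem_iff _ hc).1 h

/-- **Transfer of algebraic classes along a morphism of non-zero degree**: for `f : Y ⟶ X` of smooth
projective varieties of the same dimension with `f(ℂ)_* [Y(ℂ)] = d • [X(ℂ)]`, `d ≠ 0`, a class
`x ∈ H²ᵖ(X(ℂ); ℂ)` whose pull-back `f^* x` is algebraic is algebraic (`f_* f^* x = d • x`,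
`complexGysin_map_of_hasDegree`, and `mem_algebraicClasses_of_pushPull`).
[cite: FultonYoungTableaux1997, Appendix B §B.1 (6)–(7) and §B.2 Exercise 5] -/
theorem mem_algebraicClasses_of_map_mem_of_hasDegree (hY : IsSmoothProjective n Y)
    (hX : IsSmoothProjective n X) (f : Y ⟶ X) {d : ℤ} (hd : d ≠ 0)
    (hf : HasDegree (μ hY) (μ hX) (AlgPoints.mapContinuous (L := ℂ) f) d) {p : ℕ}
    {x : complexBetti X (2 * p)} (hx : complexBetti.map f (2 * p) x ∈ algebraicClasses Y p) :
    x ∈ algebraicClasses X p :=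
  mem_algebraicClasses_of_pushPull μ hY hX f (c := (d : ℂ)) (Int.cast_ne_zero.2 hd)
    (by rw [complexGysin_map_of_hasDegree μ hY hX f hf, Int.cast_smul_eq_zsmul]) hx

/-- For `f : Y ⟶ X` FLAT of non-zero degree between smooth projective varieties of the same
dimension, `f^* x` is algebraic iff `x` is (flat pull-back preserves `Nᵖ H²ᵖ`,
`map_mem_algebraicClasses_of_flat`; conversely `mem_algebraicClasses_of_map_mem_of_hasDegree`).
[cite: FultonYoungTableaux1997, Appendix B §B.1 (6)–(7)] [cite: GrothendieckTopology1969, §1] -/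
theorem map_mem_algebraicClasses_iff_of_hasDegree (hY : IsSmoothProjective n Y)
    (hX : IsSmoothProjective n X) (f : Y ⟶ X) [Flat f.left] {d : ℤ} (hd : d ≠ 0)
    (hf : HasDegree (μ hY) (μ hX) (AlgPoints.mapContinuous (L := ℂ) f) d) {p : ℕ}
    (x : complexBetti X (2 * p)) :
    complexBetti.map f (2 * p) x ∈ algebraicClasses Y p ↔ x ∈ algebraicClasses X p := by
  haveI : IsLocallyNoetherian Y.left := IsSmoothProjective.isLocallyNoetherian_holds hY
  haveI : IsLocallyNoetherian X.left := IsSmoothProjective.isLocallyNoetherian_holds hX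
  exact ⟨mem_algebraicClasses_of_map_mem_of_hasDegree μ hY hX f hd hf,
    map_mem_algebraicClasses_of_flat f⟩

/-- **Submodule form of the transfer**: if `f_* f^* = c • id` on `H²ᵖ(X(ℂ); ℂ)` with `c ≠ 0`, a
subspace `V ⊆ H²ᵖ(X(ℂ))` with `f^* V ⊆ W` for some `W ⊆ Nᵖ H²ᵖ(Y(ℂ))` lies in `Nᵖ H²ᵖ(X(ℂ))` (the
shape `V_m(α') ↦ V_{km}(k • α') ⊆ Alg` of the level map).
[cite: FultonYoungTableaux1997, Appendix B §B.1 (6)–(7) and §B.2 Exercise 5] -/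
theorem le_algebraicClasses_of_pushPull (hY : IsSmoothProjective n Y) (hX : IsSmoothProjective n X)
    (f : Y ⟶ X) {p : ℕ} {c : ℂ} (hc : c ≠ 0)
    (hpp : ∀ x : complexBetti X (2 * p), complexGysin μ hY hX f rfl (complexBetti.map f (2 * p) x) = c • x)
    {V : Submodule ℂ (complexBetti X (2 * p))} {W : Submodule ℂ (complexBetti Y (2 * p))}
    (hVW : ∀ x ∈ V, complexBetti.map f (2 * p) x ∈ W) (hW : W ≤ algebraicClasses Y p) :
    V ≤ algebraicClasses X p :=
  fun x hx ↦ mem_algebraicClasses_of_pushPull μ hY hX f hc (hpp x) (hW (hVW x hx))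

end Transfer

section Scalar

universe u v

variable {R : Type v} [CommRing R] {T S : Type u} [TopologicalSpace T] [TopologicalSpace S] {d : ℕ}
  {μT : HomologicalOrientation R T d} {μS : HomologicalOrientation R S d}

/-- `f_! 1 = c • 1` for `f : T → S` with `f_* [T] = c • [S]`, `c ∈ R` (the tree's
`gysinMap_one_of_hasDegree` with a ring scalar in place of an integer degree).
[cite: FultonYoungTableaux1997, Appendix B §B.1 (5) and (7)] -/
theorem gysinMap_one_of_map_fundamentalClass_eq_smul (hS : μS.HasPoincareDuality) {f : C(T, S)}
    {c : R} (hf : singularHomology.map R R f d μT.fundamentalClass = c • μS.fundamentalClass) :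
    gysinMap μT μS f (Nat.zero_add d) (Nat.zero_add d) (singularCohomology.one R T) =
      c • singularCohomology.one R S := by
  symm
  refine eq_gysinMap_of_capProduct_eq hS f _ _ ?_
  rw [one_capProduct, hf, LinearMap.map_smul, LinearMap.smul_apply, one_capProduct]

/-- `f_! (f^* x) = c • x` for `f : T → S` with `f_* [T] = c • [S]`, `c ∈ R` (projection formula with
`f_! 1 = c • 1`; the tree's `gysinMap_map_of_hasDegree` with a ring scalar).
[cite: FultonYoungTableaux1997, Appendix B §B.1 (6) and (7)] -/
theorem gysinMap_map_of_map_fundamentalClass_eq_smul (hS : μS.HasPoincareDuality) {f : C(T, S)}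
    {c : R} (hf : singularHomology.map R R f d μT.fundamentalClass = c • μS.fundamentalClass)
    {p q : ℕ} (h : p + q = d) (x : singularCohomology R R S p) :
    gysinMap μT μS f h h (singularCohomology.map R R f p x) = c • x := by
  rw [← one_cupProduct (singularCohomology.map R R f p x),
    gysinMap_cupProduct_map hS f (Nat.zero_add p) h h h (Nat.zero_add d) (Nat.zero_add d)
      (Nat.zero_add p),
    gysinMap_one_of_map_fundamentalClass_eq_smul hS hf, LinearMap.map_smul, LinearMap.smul_apply,
    one_cupProduct]

variable (μ : OrientationFamily) {n : ℕ} {Y X : Motives.SchemeOver ℂ}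

/-- **The push-pull scalar exists unconditionally**: for every morphism `f : Y ⟶ X` of smooth
projective varieties of the same dimension `n` there is `c ∈ ℂ` with `f_* (f^* x) = c • x` in EVERY
degree — `H₂ₙ(X(ℂ); ℂ) = ℂ · [X(ℂ)]_μ` (`X(ℂ)` is a closed connected manifold,
`exists_eq_smul_fundamentalClass_of_connectedSpace`), so `f(ℂ)_* [Y(ℂ)]_μ = c • [X(ℂ)]_μ`, whence
`f_* 1 = c • 1` and the projection formula. (For `f` dominant `c = deg f`; for `f` not dominant `c = 0`.)
[cite: FultonYoungTableaux1997, Appendix B §B.1 (5)–(7)] [cite: HatcherAT2002, §3.3 Thm. 3.26] -/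
theorem exists_complexGysin_map_eq_smul (hY : IsSmoothProjective n Y) (hX : IsSmoothProjective n X)
    (f : Y ⟶ X) :
    ∃ c : ℂ, ∀ (a : ℕ) (x : complexBetti X a), complexGysin μ hY hX f rfl (complexBetti.map f a x) = c • x := by
  letI := hX.chartedSpace
  haveI := ComplexPoints.compactSpace_of_isSmoothProjective hX
  haveI := ComplexPoints.t2Space_of_isSmoothProjective hX
  haveI := connectedSpace_complexPoints hX
  obtain ⟨c, hc⟩ := exists_eq_smul_fundamentalClass_of_connectedSpace (μ hX)
    (singularHomology.map ℂ ℂ (AlgPoints.mapContinuous (L := ℂ) f) (2 * n) (μ hY).fundamentalClass)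
  refine ⟨c, fun a x ↦ ?_⟩
  by_cases ha : a ≤ 2 * n
  · rw [complexGysin_eq_gysinMap hY hX f rfl (q := 2 * n - a) (by omega) (by omega)]
    exact gysinMap_map_of_map_fundamentalClass_eq_smul (OrientationFamily.hasPoincareDuality μ hX)
      hc _ x
  · haveI := subsingleton_complexBetti hX (not_le.1 ha)
    exact Subsingleton.elim _ _

/-- **`f_*` is injective in the top degree**: for `f : Y ⟶ X` of smooth projective varieties of the
same dimension `n`, `f_* : H²ⁿ(Y(ℂ); ℂ) → H²ⁿ(X(ℂ); ℂ)` is injective — it is `D_X⁻¹ ∘ f(ℂ)_* ∘ D_Y`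
with `D_Y`, `D_X` the Poincaré duality bijections and `f(ℂ)_* : H₀(Y(ℂ)) → H₀(X(ℂ))` injective, `Y(ℂ)`
being path connected (a connected manifold; Hatcher Prop. 2.7, the tree's
`singularHomology.mono_map_zero_of_pathConnectedSpace`).
[cite: FultonYoungTableaux1997, Appendix B §B.1 (5)] [cite: HatcherAT2002, Prop. 2.7 and Thm. 3.30] -/
theorem complexGysin_top_injective (hY : IsSmoothProjective n Y) (hX : IsSmoothProjective n X)
    (f : Y ⟶ X) :
    Function.Injective (complexGysin μ hY hX f (rfl : 2 * n + 2 * n = 2 * n + 2 * n)) := by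
  letI := hY.chartedSpace
  haveI := connectedSpace_complexPoints hY
  haveI : LocallyPathConnectedSpace (ComplexPoints Y) :=
    ChartedSpace.locallyPathConnectedSpace (EuclideanSpace ℝ (Fin (2 * n))) (ComplexPoints Y)
  haveI : PathConnectedSpace (ComplexPoints Y) := pathConnectedSpace_iff_connectedSpace.mpr ‹_›
  haveI := singularHomology.mono_map_zero_of_pathConnectedSpace ℂ ℂ
    (AlgPoints.mapContinuous (L := ℂ) f)
  rw [complexGysin_eq_gysinMap hY hX f rfl (q := 0) rfl rfl, injective_iff_map_eq_zero]
  intro y hy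
  have h := capProduct_gysinMap (OrientationFamily.hasPoincareDuality μ hX)
    (AlgPoints.mapContinuous (L := ℂ) f) (rfl : 2 * n + 0 = 2 * n) rfl y (μY := μ hY)
  rw [hy, LinearMap.map_zero, LinearMap.zero_apply, eq_comm,
    ← (singularHomology.map ℂ ℂ (AlgPoints.mapContinuous (L := ℂ) f) 0).hom.map_zero] at h
  have h' := (ModuleCat.mono_iff_injective _).1 ‹_› h
  rw [← poincareDualityMap_apply, ← (poincareDualityMap (μ hY) (rfl : 2 * n + 0 = 2 * n)).map_zero] at h'
  exact (OrientationFamily.hasPoincareDuality μ hY (rfl : 2 * n + 0 = 2 * n)).1 h'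

/-- **The push-pull scalar is non-zero as soon as `f^*` is non-zero in the top degree**: if
`f_* f^* = c •` (in degree `2n`) and `f^* ω ≠ 0` for some `ω ∈ H²ⁿ(X(ℂ); ℂ)`, then `c ≠ 0`
(`f_*` is injective in the top degree, `complexGysin_top_injective`). For the level map
`π : X_{km} → X_m` this reduces the degree input (M5) to "`π^*` is non-zero on `H^{4r}(X²ʳₘ(ℂ); ℂ)`".
[cite: FultonYoungTableaux1997, Appendix B §B.1 (5)–(7)] [cite: HatcherAT2002, Prop. 2.7] -/
theorem pushPull_scalar_ne_zero (hY : IsSmoothProjective n Y) (hX : IsSmoothProjective n X)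
    (f : Y ⟶ X) {c : ℂ}
    (hc : ∀ x : complexBetti X (2 * n), complexGysin μ hY hX f rfl (complexBetti.map f (2 * n) x) = c • x)
    {ω : complexBetti X (2 * n)} (hω : complexBetti.map f (2 * n) ω ≠ 0) : c ≠ 0 := by
  rintro rfl
  apply hω
  apply complexGysin_top_injective μ hY hX f
  rw [hc ω, zero_smul, LinearMap.map_zero]

end Scalar

/-! ### The degenerate levels and dimensions of `FermatCharacter.Claim` -/

section Degenerate

/-- **At level `m = 0` the standard model `V₊(Σ xᵢ⁰) = V₊(n + 2) ⊂ ℙⁿ⁺¹` is empty**: the Fermat form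
of exponent `0` is the non-zero constant `n + 2`, a unit, and no relevant homogeneous prime contains a
unit (the image of the closed immersion `hypersurfaceι` is the zero locus,
`SmoothHypersurface.range_hypersurfaceι`). [folklore] -/
theorem isEmpty_fermatHypersurface_zero_left (n : ℕ) : IsEmpty ↥(fermatHypersurface n 0).left := by
  letI := MvPolynomial.gradedAlgebra (σ := Fin (n + 2)) (R := ℂ)
  refine ⟨fun x ↦ ?_⟩
  have hunit : IsUnit (fermatPolynomial ℂ n 0) := by
    have h : fermatPolynomial ℂ n 0 = ((n + 2 : ℕ) : MvPolynomial (Fin (n + 2)) ℂ) := by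
      simp only [fermatPolynomial, pow_zero, Finset.sum_const, Finset.card_univ, Fintype.card_fin,
        nsmul_eq_mul, mul_one]
    rw [h, ← map_natCast (algebraMap ℂ (MvPolynomial (Fin (n + 2)) ℂ))]
    refine IsUnit.map _ ?_
    rw [isUnit_iff_ne_zero]
    exact_mod_cast Nat.succ_ne_zero (n + 1)
  have hx : (SmoothHypersurface.hypersurfaceι (fermatPolynomial ℂ n 0)).left.base x ∈
      Set.range (SmoothHypersurface.hypersurfaceι (fermatPolynomial ℂ n 0)).left.base := ⟨x, rfl⟩
  rw [SmoothHypersurface.range_hypersurfaceι] at hx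
  have hx' : fermatPolynomial ℂ n 0 ∈
      ((SmoothHypersurface.hypersurfaceι (fermatPolynomial ℂ n 0)).left.base x :
        ProjectiveSpectrum (MvPolynomial.homogeneousSubmodule (Fin (n + 2)) ℂ)).asHomogeneousIdeal :=
    Set.singleton_subset_iff.1 ((ProjectiveSpectrum.mem_zeroLocus _ _ _).1 hx)
  exact ((SmoothHypersurface.hypersurfaceι (fermatPolynomial ℂ n 0)).left.base x :
    ProjectiveSpectrum _).isPrime.ne_top (Ideal.eq_top_of_isUnit_mem _ hx' hunit)

/-- **claim is trivial at level `0`**: `X²ʳ₀(ℂ) = ∅`, so `H²ʳ(X²ʳ₀(ℂ); ℂ) = 0` and every eigenspace is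
`0`. [folklore] -/
theorem claim_level_zero (r : ℕ) (α : Fin (2 * r + 2) → ZMod 0) : FermatCharacter.Claim 0 r α := by
  intro x _
  haveI : IsEmpty (ComplexPoints (fermatHypersurface (2 * r) 0)) :=
    ⟨fun P ↦ (isEmpty_fermatHypersurface_zero_left (2 * r)).false P.pt⟩
  haveI := ModuleCat.subsingleton_of_isZero
    (isZero_singularCohomology_of_isEmpty ℂ ℂ (E := ComplexPoints (fermatHypersurface (2 * r) 0)) (2 * r))
  exact (Subsingleton.elim x 0).symm ▸ Submodule.zero_mem _

end Degenerate

/-! ### S2↓ `stub_claimLevelPush` from the level map -/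

section LevelPush

/-- **S2↓ from the level map, push-pull form.** GRANTED, for all `m, k, r ≥ 1`, an orientation family
`μ`, a morphism `π : X²ʳ_{km} ⟶ X²ʳₘ` of the standard models (intended: `[xᵢ] ↦ [xᵢᵏ]`), a scalar
`c ≠ 0` with `π_* (π^* x) = c • x` on `H²ʳ(X²ʳₘ(ℂ); ℂ)` (intended: `c = deg π = k^{2r+1}`), and the
eigenspace compatibility `π^* V_m(α') ⊆ V_{km}(k • α')` for zero-free `α'` (intended: from
`π ∘ g_a = g_{aᵏ} ∘ π`), claim pushes forward along the level map: claim_{km}(k • α') ⟹ claim_m(α')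
for every `k ≥ 1` and zero-free `α'` of level `m` — the registered statement of `stub_claimLevelPush`.
Proof: `V_m(α') ∋ x ↦ π^* x ∈ V_{km}(k • α') ⊆ Alg(X_{km})`, so `x = c⁻¹ π_* π^* x ∈ π_*(Alg) ⊆ Alg(X_m)`
(`mem_algebraicClasses_of_pushPull`); `r = 0`, `m = 0` are `FermatCharacter.claim_zero`, `claim_level_zero`.
REMAINING CONSTRUCTIONS (not in the tree): the morphism `π` (M1), (M2), the push-pull scalar (M5).
[cite: Aoki1987, §1 p. 387 and Cor. 2-3 (p. 388)] [cite: ShiodaKatsura1979, §1]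
[cite: FultonYoungTableaux1997, Appendix B §B.1 (6)–(7) and §B.2 Exercise 5] -/
theorem stub_claimLevelPush_of_pushPull :
    (∀ (m k r : ℕ), 1 ≤ m → 1 ≤ k → 1 ≤ r →
      ∀ (hY : IsSmoothProjective (2 * r) (fermatHypersurface (2 * r) (k * m)))
        (hX : IsSmoothProjective (2 * r) (fermatHypersurface (2 * r) m)),
      ∃ (μ : OrientationFamily) (π : fermatHypersurface (2 * r) (k * m) ⟶ fermatHypersurface (2 * r) m)
        (c : ℂ), c ≠ 0 ∧
        (∀ x : complexBetti (fermatHypersurface (2 * r) m) (2 * r),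
          complexGysin μ hY hX π rfl (complexBetti.map π (2 * r) x) = c • x) ∧
        ∀ α' : Fin (2 * r + 2) → ZMod m, (∀ i, α' i ≠ 0) →
          ∀ x ∈ fermatEigenspace m α' (2 * r),
            complexBetti.map π (2 * r) x ∈
              fermatEigenspace (k * m) (fun i => ((k * (α' i).val : ℕ) : ZMod (k * m))) (2 * r)) →
    ∀ (m k r : ℕ) (α' : Fin (2 * r + 2) → ZMod m), 0 < k → (∀ i, α' i ≠ 0) →
      FermatCharacter.Claim (k * m) r (fun i => ((k * (α' i).val : ℕ) : ZMod (k * m))) →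
        FermatCharacter.Claim m r α' := by
  intro hM m k r α' hk hα' hC
  rcases Nat.eq_zero_or_pos r with rfl | hr
  · exact FermatCharacter.claim_zero m α'
  rcases Nat.eq_zero_or_pos m with rfl | hm
  · exact claim_level_zero r α'
  have hY : IsSmoothProjective (2 * r) (fermatHypersurface (2 * r) (k * m)) :=
    isSmoothProjective_fermatHypersurface (by omega) (Nat.mul_pos hk hm)
  have hX : IsSmoothProjective (2 * r) (fermatHypersurface (2 * r) m) :=
    isSmoothProjective_fermatHypersurface (by omega) hm
  obtain ⟨μ, π, c, hc, hpp, hV⟩ := hM m k r hm hk hr hY hX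
  intro x hx
  exact mem_algebraicClasses_of_pushPull μ hY hX π hc (hpp x) (hC (hV α' hα' x hx))

/-- **S2↓ `stub_claimLevelPush` from the level map, degree form.** GRANTED, for all `m, k, r ≥ 1`, a
morphism `π : X²ʳ_{km} ⟶ X²ʳₘ` of the standard models (intended: `[xᵢ] ↦ [xᵢᵏ]`) with (M5)
`π(ℂ)_* [X²ʳ_{km}(ℂ)]_μ = d • [X²ʳₘ(ℂ)]_μ` for an integer `d ≠ 0` (intended: `d = k^{2r+1}`) and (M2)
`π^* V_m(α') ⊆ V_{km}(k • α')` for zero-free `α'`, claim pushes forward along the level map: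
claim_{km}(k • α') ⟹ claim_m(α') — the registered statement of `stub_claimLevelPush` (`π_* π^* = d •`,
`complexGysin_map_of_hasDegree`, then `stub_claimLevelPush_of_pushPull`). REMAINING CONSTRUCTIONS (not
in the tree, 2026-08-16): (M1) the morphism `fermatHypersurface (2r) (km) ⟶ fermatHypersurface (2r) m`,
`[xᵢ] ↦ [xᵢᵏ]`; (M2) its intertwining with the diagonal symmetries on `fermatEigenspace`; (M5) its degree.
[cite: Aoki1987, §1 p. 387 and Cor. 2-3 (p. 388)] [cite: ShiodaKatsura1979, §1]
[cite: daSilva2021HodgeFermat, Thm. 2.8] [cite: FultonYoungTableaux1997, Appendix B §B.1 (5)–(7)] -/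
theorem stub_claimLevelPush_of_levelMap :
    ∀ (μ : OrientationFamily), (∀ (m k r : ℕ), 1 ≤ m → 1 ≤ k → 1 ≤ r →
      ∃ (π : fermatHypersurface (2 * r) (k * m) ⟶ fermatHypersurface (2 * r) m) (d : ℤ), d ≠ 0 ∧
        (∀ (hY : IsSmoothProjective (2 * r) (fermatHypersurface (2 * r) (k * m)))
          (hX : IsSmoothProjective (2 * r) (fermatHypersurface (2 * r) m)),
          HasDegree (μ hY) (μ hX) (AlgPoints.mapContinuous (L := ℂ) π) d) ∧
        ∀ α' : Fin (2 * r + 2) → ZMod m, (∀ i, α' i ≠ 0) →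
          ∀ x ∈ fermatEigenspace m α' (2 * r),
            complexBetti.map π (2 * r) x ∈
              fermatEigenspace (k * m) (fun i => ((k * (α' i).val : ℕ) : ZMod (k * m))) (2 * r)) →
    ∀ (m k r : ℕ) (α' : Fin (2 * r + 2) → ZMod m), 0 < k → (∀ i, α' i ≠ 0) →
      FermatCharacter.Claim (k * m) r (fun i => ((k * (α' i).val : ℕ) : ZMod (k * m))) →
        FermatCharacter.Claim m r α' := by
  intro μ hM
  refine stub_claimLevelPush_of_pushPull fun m k r hm hk hr hY hX ↦ ?_
  obtain ⟨π, d, hd, hdeg, hV⟩ := hM m k r hm hk hr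
  exact ⟨μ, π, (d : ℂ), Int.cast_ne_zero.2 hd,
    fun x ↦ by rw [complexGysin_map_of_hasDegree μ hY hX π (hdeg hY hX), Int.cast_smul_eq_zsmul], hV⟩

/-- **S2↓ `stub_claimLevelPush` from the level map, top-degree form (weakest input).** GRANTED, for
all `m, k, r ≥ 1`, a morphism `π : X²ʳ_{km} ⟶ X²ʳₘ` of the standard models (intended: `[xᵢ] ↦ [xᵢᵏ]`)
such that (M5′) `π^*` is non-zero on the top degree `H⁴ʳ(X²ʳₘ(ℂ); ℂ)` (a line; for the level map
`π^* [pt] = k^{2r+1} [pt]`) and (M2) `π^* V_m(α') ⊆ V_{km}(k • α')` for zero-free `α'`, claim pushes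
forward along the level map: claim_{km}(k • α') ⟹ claim_m(α') — the registered statement of
`stub_claimLevelPush`. The push-pull scalar `c` with `π_* π^* = c •` exists unconditionally
(`exists_complexGysin_map_eq_smul`, any orientation family, `ComplexPoints.isOrientableOver`) and is
non-zero by (M5′) (`pushPull_scalar_ne_zero`); then `stub_claimLevelPush_of_pushPull`. REMAINING
CONSTRUCTIONS (not in the tree, 2026-08-16): (M1) the morphism `π`, (M2), (M5′).
[cite: Aoki1987, §1 p. 387 and Cor. 2-3 (p. 388)] [cite: ShiodaKatsura1979, §1]
[cite: FultonYoungTableaux1997, Appendix B §B.1 (5)–(7) and §B.2 Exercise 5] -/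
theorem stub_claimLevelPush_of_map_top_ne_zero :
    (∀ (m k r : ℕ), 1 ≤ m → 1 ≤ k → 1 ≤ r →
      ∃ π : fermatHypersurface (2 * r) (k * m) ⟶ fermatHypersurface (2 * r) m,
        (∃ ω : complexBetti (fermatHypersurface (2 * r) m) (2 * (2 * r)),
          complexBetti.map π (2 * (2 * r)) ω ≠ 0) ∧
        ∀ α' : Fin (2 * r + 2) → ZMod m, (∀ i, α' i ≠ 0) →
          ∀ x ∈ fermatEigenspace m α' (2 * r),
            complexBetti.map π (2 * r) x ∈
              fermatEigenspace (k * m) (fun i => ((k * (α' i).val : ℕ) : ZMod (k * m))) (2 * r)) →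
    ∀ (m k r : ℕ) (α' : Fin (2 * r + 2) → ZMod m), 0 < k → (∀ i, α' i ≠ 0) →
      FermatCharacter.Claim (k * m) r (fun i => ((k * (α' i).val : ℕ) : ZMod (k * m))) →
        FermatCharacter.Claim m r α' := by
  intro hM
  refine stub_claimLevelPush_of_pushPull fun m k r hm hk hr hY hX ↦ ?_
  obtain ⟨π, ⟨ω, hω⟩, hV⟩ := hM m k r hm hk hr
  let μ : OrientationFamily := fun _ _ h ↦ (ComplexPoints.isOrientableOver ℂ h).some
  obtain ⟨c, hc⟩ := exists_complexGysin_map_eq_smul μ hY hX π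
  exact ⟨μ, π, c, pushPull_scalar_ne_zero μ hY hX π (hc (2 * (2 * r))) hω, hc (2 * r), hV⟩

end LevelPush

end Summit.HodgeConjecture.HodgeConjecture.Theorems.CancelByAnyClaimLattice

end
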